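import Mathlib
import HarnessLib
import Literature.MathematicalPhysics.StatisticalMechanics.LinearisedMapABKM
import Literature.MathematicalPhysics.StatisticalMechanics.FluctuationSmooth
import Literature.MathematicalPhysics.StatisticalMechanics.FluctuationDefect
import Literature.MathematicalPhysics.StatisticalMechanics.StepOperatorAGamma
import Literature.MathematicalPhysics.StatisticalMechanics.ActivitySpace

/-!
# Step-kernel bounds: the facts about the fluctuation kernel `𝒞^{(q)}_{k+1}` consumed by the
# norm estimates of one renormalisation step, decoupled from the `q = 0` weights ([ABKM19] Lemma 7.7
# "we later need the integration property not only for `μ_{k+1}^{(0)}` but also for `q ∈ B_κ`")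

In [ABKM19] the weights `w_k^X`, `w_{k:k+1}^X` of Theorem 7.1 are built ONCE, from the finite-range
decomposition `𝒞^{(0)}` of `(−Δ)⁻¹` ("`𝒞_k = 𝒞_k^{(0)}` satisfy the assumptions of Theorem 7.1",
Ch. 7.3), so that the norms `‖·‖_k` of all the renormalisation maps `T_k^{(q)}`, `q ∈ B_κ`, are the
SAME norms — this is what the fine-tuning argument of Ch. 12 (two systems compared in one family of
norms, Lemma 12.6) requires — while the STEP `k → k+1` of `T_k^{(q)}` integrates against
`μ_{k+1}^{(q)} = N(0, 𝒞^{(q)}_{k+1})`.  The landed step estimates of the tree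
(`StepOperatorBABKM`, `NextHamiltonianBounds`, `LinearisedMapABKMContraction`, …, `RGStepABKM`) take
the step kernel EQUAL to the weight kernel (`hD𝒞 : D.𝒞 = 𝒞 (k+1)`, i.e. `q = 0`).  What they consume
of the step kernel is only the following list, recorded here as the predicate
**`StepKernelBounds W L k A𝒫 C₂ 𝒞q`** of a kernel `𝒞q` RELATIVE to weight data `W` at scale `k`:

* `posSemidef` — `circulant 𝒞q ⪰ 0` (the step measure is a genuine Gaussian; `R_{k+1}` of
  polynomials, `FluctuationOfHamiltonian.nextH_eq`);
* `cov_sub` — `W.cov k − circulant 𝒞q ⪰ 0` (integrability of `w_k^X(φ + ·)`; for the torus data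
  `W.cov k = (1+θ̄)·circulant 𝒞^{(0)}_{k+1}`, so this is `𝒞^{(q)}_{k+1} ⪯ (1+θ̄)𝒞^{(0)}_{k+1}`,
  [ABKM19] (7.75));
* `subcritical` — a margin `η > 0` with `1 − √𝒞q ((1+η)A_k^X) √𝒞q ≻ 0` for every `X` (domination
  of the weight along the section of every gauge: smoothness of `R_{k+1}K`, Lemma 8.4);
* `integral` — **(w7′)** `∫ w_k^X(φ + ψ) N(0, circulant 𝒞q)(dψ) ≤ A𝒫^{|X|_k} w_{k:k+1}^X(φ)` for
  `k`-polymers `X` (Theorem 7.1 (w7) for `q ∈ B_κ`);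
* `gradCov_le` — `L^{dk} |γ_q(𝒞q)| ≤ C₂` for the shift `γ = gradCov 𝒞q` of the quadratic
  monomials under `R_{k+1}` (Lemma 10.5 (10.39), clause (iv) of the decomposition).

Proved here: the `q = 0` instance **`AbkmWeightBounds.stepKernelBounds`** (the weight kernel
`𝒞_{k+1}` itself satisfies the predicate relative to `abkmWeightData … 𝒞`, with `C₂ =
secondDiffConst Cα`), and the base lemmas of the step chain with the kernel equality replaced by the
predicate: `StepKernelBounds.weightSectionDominated`, `.integrable_weight`, `.integral_stepMeasure_le`,
`.contDiff_fluct`, `.integrable_comp_add`, and for the concrete parameters `abkmNormParams`: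
**`integrationProperty_of_stepKernelBounds`** ((w7′) ⇒ `IntegrationProperty P k 𝒞q A𝒫`, Lemma 8.4
with `ℓ = 0`), `contDiff_fluct_of_weakNormLE_of_stepKernelBounds`, `abs_gradCov_le_of_stepKernelBounds`.
The algebraic clauses of the decomposition used by the FACTORISATION of `K_{k+1}` (zero sum,
positivity on mean-zero fields, signed finite range: hypotheses of `RenormalisationMap.factorises_nextKStep`)
are not part of the predicate.  Not here: the instance for `q ≠ 0` (kernels with Fourier multipliers
`0 ≤ ĉq ≤ (1+ρ)ĉ_{k+1}`, `ρ < θ̄/(2+θ̄)`: Lemma 7.7 for `q ∈ B_κ`).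

Everything is proved; no named fact.

## References
* S. Adams, S. Buchholz, R. Kotecký, S. Müller, arXiv:1910.13564, Theorem 7.1 (w7), Lemma 7.7 and its
  proof ((7.74)–(7.76)), Lemma 8.4, Lemma 10.5 (10.39), Ch. 12 (Lemma 12.6)
  [AdamsBuchholzKoteckyMuller2019].
-/

noncomputable section

namespace Literature.MathematicalPhysics.StatisticalMechanics.GradientRG

open scoped BigOperators Classical MatrixOrder
open Finset Matrix MeasureTheory ProbabilityTheory WithLp
open Literature.MathematicalPhysics.StatisticalMechanics.GradientFRD (cExt fourierCoeff mulMat)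
open Literature.MathematicalPhysics.StatisticalMechanics.TorusPolymer (IsPolymer numBlocks)
open Literature.Barriers.CriticalPhenomena.LongRangePhi4.Polymer (IsConn)
open Literature.MathematicalPhysics.QuantumFieldTheory

variable {d M : ℕ} [NeZero M]

/-! ## The predicate -/

/-- **The facts about a step kernel `𝒞q` (covariance `circulant 𝒞q` of `μ_{k+1}`) consumed by the norm
estimates of the renormalisation step `k → k+1`, relative to weight data `W`**: positive
semi-definiteness, domination by the weights' step covariance `W.cov k`, a subcriticality margin for
`A_k^X`, the integration property (w7′) with constant `A𝒫`, and the bound `L^{dk}|γ_q| ≤ C₂` for the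
shift of the quadratic monomials. [cite: AdamsBuchholzKoteckyMuller2019, Lemma 7.7] -/
structure StepKernelBounds (W : WeightData (Fin d → ZMod M)) (L k : ℕ) (A𝒫 C₂ : ℝ)
    (𝒞q : (Fin d → ZMod M) → ℝ) : Prop where
  /-- `circulant 𝒞q ⪰ 0` -/
  posSemidef : (Matrix.circulant 𝒞q).PosSemidef
  /-- `circulant 𝒞q ⪯ W.cov k` ([ABKM19] (7.75): `𝒞^{(q)}_{k+1} ⪯ (1+ρ)𝒞^{(0)}_{k+1}`) -/
  cov_sub : (W.cov k - Matrix.circulant 𝒞q).PosSemidef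
  /-- subcriticality of `(1+η)A_k^X` for `circulant 𝒞q`, some margin `η > 0`, every `X` -/
  subcritical : ∃ η : ℝ, 0 < η ∧ ∀ X : Finset (Fin d → ZMod M),
    ((1 : Matrix (Fin d → ZMod M) (Fin d → ZMod M) ℝ) -
      CFC.sqrt (Matrix.circulant 𝒞q) * ((1 + η) • W.form k X) * CFC.sqrt (Matrix.circulant 𝒞q)).PosDef
  /-- (w7′): `∫ w_k^X(φ + ψ) N(0, circulant 𝒞q)(dψ) ≤ A𝒫^{|X|_k} w_{k:k+1}^X(φ)` for `k`-polymers -/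
  integral : ∀ X : Finset (Fin d → ZMod M), IsPolymer (L ^ k) X → ∀ φ : (Fin d → ZMod M) → ℝ,
    ∫ ψ, W.weight k X (φ + ofLp ψ) ∂(multivariateGaussian 0 (Matrix.circulant 𝒞q)) ≤
      A𝒫 ^ numBlocks (L ^ k) X * W.midWeight k X φ
  /-- `L^{dk} |γ_q| ≤ C₂` for `γ = gradCov 𝒞q` -/
  gradCov_le : ∀ q : quadIndex d, ((L ^ (d * k) : ℕ) : ℝ) * |gradCov 𝒞q q| ≤ C₂

namespace StepKernelBounds

variable {W : WeightData (Fin d → ZMod M)} {L k : ℕ} {A𝒫 C₂ : ℝ} {𝒞q : (Fin d → ZMod M) → ℝ}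

/-- A larger constant `C₂' ≥ C₂` is still a bound. [cite: AdamsBuchholzKoteckyMuller2019, Lemma 10.5 (10.39)] -/
theorem mono_C₂ (hS : StepKernelBounds W L k A𝒫 C₂ 𝒞q) {C₂' : ℝ} (h : C₂ ≤ C₂') :
    StepKernelBounds W L k A𝒫 C₂' 𝒞q :=
  { posSemidef := hS.posSemidef
    cov_sub := hS.cov_sub
    subcritical := hS.subcritical
    integral := hS.integral
    gradCov_le := fun q => (hS.gradCov_le q).trans h }

/-- **`w_k^X` is dominated along the section of every gauge `T` for `μ_{k+1} = stepMeasure 𝒞q`**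
(from the subcriticality margin; `W` dominated so that `A_k^X ⪰ 0`).
[cite: AdamsBuchholzKoteckyMuller2019, Lemma 8.4 (proof)] -/
theorem weightSectionDominated (hS : StepKernelBounds W L k A𝒫 C₂ 𝒞q)
    {D : ℕ → Matrix (Fin d → ZMod M) (Fin d → ZMod M) ℝ} (hD : W.Dominated D)
    (X : Finset (Fin d → ZMod M)) {V : Type*} [NormedAddCommGroup V] [NormedSpace ℝ V]
    (T : ((Fin d → ZMod M) → ℝ) →ₗ[ℝ] V) :
    WeightSectionDominated T (W.weight k X) (stepMeasure 𝒞q) := by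
  obtain ⟨η, hη, hsub⟩ := hS.subcritical
  have hwe : W.weight k X = expWeight (W.form k X) :=
    funext fun φ => WeightData.weight_eq_expWeight k X φ
  rw [hwe]
  exact weightSectionDominated_expWeight T (C := Matrix.circulant 𝒞q)
    (WeightData.form_posSemidef hD k X) hη (hsub X)

/-- **`w_k^X(φ + ·)` is `μ_{k+1}`-integrable** (`circulant 𝒞q ⪰ 0`, `circulant 𝒞q ⪯ W.cov k`).
[cite: AdamsBuchholzKoteckyMuller2019, Lemma 8.4] -/
theorem integrable_weight (hS : StepKernelBounds W L k A𝒫 C₂ 𝒞q)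
    {D : ℕ → Matrix (Fin d → ZMod M) (Fin d → ZMod M) ℝ} (hD : W.Dominated D)
    (X : Finset (Fin d → ZMod M)) (φ : (Fin d → ZMod M) → ℝ) :
    Integrable (fun ξ : (Fin d → ZMod M) → ℝ => W.weight k X (φ + ξ)) (stepMeasure 𝒞q) :=
  integrable_weight_of_dominated W hD hS.posSemidef hS.cov_sub X φ

/-- **(w7′) on field space**: `∫ w_k^X(φ + ξ) μ_{k+1}(dξ) ≤ A𝒫^{|X|_k} w_{k:k+1}^X(φ)` for
`k`-polymers `X`. [cite: AdamsBuchholzKoteckyMuller2019, Theorem 7.1 (w7)] -/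
theorem integral_stepMeasure_le (hS : StepKernelBounds W L k A𝒫 C₂ 𝒞q)
    {X : Finset (Fin d → ZMod M)} (hX : IsPolymer (L ^ k) X) (φ : (Fin d → ZMod M) → ℝ) :
    ∫ ξ, W.weight k X (φ + ξ) ∂(stepMeasure 𝒞q) ≤ A𝒫 ^ numBlocks (L ^ k) X * W.midWeight k X φ := by
  rw [integral_stepMeasure (continuous_weight_comp_add _ k X φ)]
  exact hS.integral X hX φ

/-- `A𝒫 ≥ 0` as soon as some `k`-polymer with an odd number of blocks exists — here the
convenient form: `0 ≤ A𝒫 ^ |X|_k · w_{k:k+1}^X(φ)` for every `k`-polymer `X` (the left side of (w7′)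
is an integral of a positive function). [cite: AdamsBuchholzKoteckyMuller2019, Theorem 7.1 (w7)] -/
theorem pow_mul_midWeight_nonneg (hS : StepKernelBounds W L k A𝒫 C₂ 𝒞q)
    {X : Finset (Fin d → ZMod M)} (hX : IsPolymer (L ^ k) X) (φ : (Fin d → ZMod M) → ℝ) :
    0 ≤ A𝒫 ^ numBlocks (L ^ k) X * W.midWeight k X φ :=
  (integral_nonneg fun _ => (W.weight_pos k X _).le).trans (hS.integral X hX φ)

/-- **`R_{k+1}K = fluct 𝒞q K` is `C^{r₀}`** for a `T`-local `C^{r₀}` functional with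
`‖K‖_{T, w_k^X} ≤ C` (`C ≥ 0`, `W` dominated). [cite: AdamsBuchholzKoteckyMuller2019, Lemma 8.4] -/
theorem contDiff_fluct (hS : StepKernelBounds W L k A𝒫 C₂ 𝒞q)
    {D : ℕ → Matrix (Fin d → ZMod M) (Fin d → ZMod M) ℝ} (hD : W.Dominated D)
    (X : Finset (Fin d → ZMod M)) {V : Type*} [NormedAddCommGroup V] [NormedSpace ℝ V]
    (T : ((Fin d → ZMod M) → ℝ) →ₗ[ℝ] V) {r₀ : ℕ} {K : ((Fin d → ZMod M) → ℝ) → ℂ} {C : ℝ}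
    (hC : 0 ≤ C) (hKd : ContDiff ℝ r₀ K) (hKloc : IsGaugeLocal T K)
    (hK : TayNormLE T r₀ (W.weight k X) K C) :
    ContDiff ℝ r₀ (fluct 𝒞q K) :=
  contDiff_integral_comp_add_of_tayNormLE hK hC hKd hKloc (hS.weightSectionDominated hD X T)

/-- **`K(φ + ·)` is `μ_{k+1}`-integrable** for a `T`-local `C^{r₀}` functional with
`‖K‖_{T, w_k^X} ≤ C`. [cite: AdamsBuchholzKoteckyMuller2019, Lemma 8.4] -/
theorem integrable_comp_add (hS : StepKernelBounds W L k A𝒫 C₂ 𝒞q)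
    {D : ℕ → Matrix (Fin d → ZMod M) (Fin d → ZMod M) ℝ} (hD : W.Dominated D)
    (X : Finset (Fin d → ZMod M)) {V : Type*} [NormedAddCommGroup V] [NormedSpace ℝ V]
    (T : ((Fin d → ZMod M) → ℝ) →ₗ[ℝ] V) {r₀ : ℕ} {K : ((Fin d → ZMod M) → ℝ) → ℂ} {C : ℝ}
    (hC : 0 ≤ C) (hKd : ContDiff ℝ r₀ K) (hKloc : IsGaugeLocal T K)
    (hK : TayNormLE T r₀ (W.weight k X) K C) (φ : (Fin d → ZMod M) → ℝ) :
    Integrable (fun ξ => K (φ + ξ)) (stepMeasure 𝒞q) :=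
  integrable_comp_add_of_tayNormLE hK hC hKd hKloc (hS.weightSectionDominated hD X T) φ

/-- **(w7′) ⇒ the integration property in the norms**: `‖R_{k+1}K‖_{T, w_{k:k+1}^X} ≤ A𝒫^{|X|_k} C`
for a `k`-polymer `X`, a `T`-local `C^{r₀}` functional `K` with `‖K‖_{T, w_k^X} ≤ C`.
[cite: AdamsBuchholzKoteckyMuller2019, Lemma 8.4 (8.5)] -/
theorem tayNormLE_fluct (hS : StepKernelBounds W L k A𝒫 C₂ 𝒞q)
    {D : ℕ → Matrix (Fin d → ZMod M) (Fin d → ZMod M) ℝ} (hD : W.Dominated D)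
    {X : Finset (Fin d → ZMod M)} (hX : IsPolymer (L ^ k) X)
    {V : Type*} [NormedAddCommGroup V] [NormedSpace ℝ V]
    (T : ((Fin d → ZMod M) → ℝ) →ₗ[ℝ] V) {r₀ : ℕ} {K : ((Fin d → ZMod M) → ℝ) → ℂ} {C : ℝ}
    (hC : 0 ≤ C) (hKd : ContDiff ℝ r₀ K) (hKloc : IsGaugeLocal T K)
    (hK : TayNormLE T r₀ (W.weight k X) K C) :
    TayNormLE T r₀ (W.midWeight k X) (fluct 𝒞q K) (C * A𝒫 ^ numBlocks (L ^ k) X) :=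
  hK.integral_comp_add_section hC hKd hKloc (hS.weightSectionDominated hD X T)
    (hS.integrable_weight hD X) (fun φ => hS.integral_stepMeasure_le hX φ)

end StepKernelBounds

/-! ## The `q = 0` instance: the weight kernel itself -/

/-- **The weight tower's own step kernel `𝒞_{k+1}` satisfies `StepKernelBounds`** relative to
`abkmWeightData … 𝒞`, with the integration constant `A𝒫` of Theorem 7.1 and `C₂ = secondDiffConst Cα`
from clause (iv) (`k + 1 ≤ N + 1`, `θ̄ > 0`, `λ > 0`, `d ≥ 2`, `n ≥ 2`, `L ≥ 1`): the case `q = 0`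
of [ABKM19] Lemma 7.7. [cite: AdamsBuchholzKoteckyMuller2019, Lemma 7.7] -/
theorem AbkmWeightBounds.stepKernelBounds {L N Mord R n : ℕ} {θbar lam μ δ₁ δ₀ A𝒫 : ℝ}
    {𝒞 : ℕ → (Fin d → ZMod M) → ℝ} (hθbar : 0 < θbar) (hlam : 0 < lam)
    (hB : AbkmWeightBounds L N Mord R n θbar lam μ δ₁ δ₀ A𝒫 𝒞
      (abkmWeightData L N Mord R θbar (schedDelta δ₀ δ₁ N) 𝒞))
    (hd : 2 ≤ d) (hn : 2 ≤ n) (hL : 1 ≤ L) {Cα : (Fin d → ℕ) → ℝ}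
    (hCα : ∀ j, 1 ≤ j → j ≤ N + 1 → ∀ θ' : Fin d → ℕ, ∑ i, θ' i ≤ n →
      ∀ x, |GradientFRD.iterDiff θ' (𝒞 j) x| ≤ Cα θ' / (L : ℝ) ^ ((j - 1) * (d - 2 + ∑ i, θ' i)))
    {k : ℕ} (hk : k + 1 ≤ N + 1) :
    StepKernelBounds (abkmWeightData L N Mord R θbar (schedDelta δ₀ δ₁ N) 𝒞) L k A𝒫
      (secondDiffConst Cα) (𝒞 (k + 1)) := by
  set W := abkmWeightData L N Mord R θbar (schedDelta δ₀ δ₁ N) 𝒞 with hW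
  have heven_all : ∀ j ∈ Icc 1 (N + 1), ∀ x, 𝒞 j (-x) = 𝒞 j x := fun j hj => (hB.zero_sum_even j hj).2
  have heven : ∀ x, 𝒞 (k + 1) (-x) = 𝒞 (k + 1) x :=
    heven_all (k + 1) (mem_Icc.2 ⟨by omega, hk⟩)
  have hf_even := fun κ j => GradientFRD.cExt_fourierCoeff_neg (N := N) heven_all κ j
  have hnn := hB.multipliers_nonneg
  have hD := hB.dominated
  have hθlo : θbar ≤ thetaSeq θbar μ δ₁ N k := (hB.theta_mem k).1
  have hCeq := circulant_eq_mulMat_cExt hk heven (N := N)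
  have hcov : W.cov k = mulMat fun κ => (1 + θbar) * cExt N (fun j => fourierCoeff (𝒞 j) κ) (k + 1) :=
    rfl
  refine
    { posSemidef := posSemidef_circulant_abkm hB hk
      cov_sub := ?_
      subcritical := ⟨θbar / 2, by linarith, fun X => ?_⟩
      integral := fun X hX φ => hB.integral k hk X hX φ
      gradCov_le := fun q => abs_gradCov_abkm_le hd hn hL hCα hk q }
  · rw [hcov, hCeq]
    exact GradientFRD.posSemidef_mulMat_sub fun κ => by nlinarith [hnn (k + 1) κ]
  · rw [hCeq]
    exact posDef_one_sub_smul_form W (c := fun j κ => cExt N (fun j => fourierCoeff (𝒞 j) κ) j)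
      hD hθbar hθlo hlam.le (by linarith) (by linarith)
      (fun k κ => derivMul_neg _ k _ κ) (fun κ => derivMul_nonneg (Nat.cast_nonneg L) k _ κ)
      (fun κ => hf_even κ (k + 1)) (fun κ => hnn (k + 1) κ)
      (fun k κ => tailMul_neg_of_cExt hf_even k κ) (fun κ => tailMul_succ N _ k κ)
      (fun κ => tailMul_nonneg (fun κ j => hnn j κ) (k + 1) κ) X

/-! ## The base lemmas of the step chain for the concrete parameters, kernel by predicate -/

/-- **(w7′) / Lemma 8.4 (`ℓ = 0`) for the concrete parameters and a step kernel by predicate**: if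
`𝒞q` satisfies `StepKernelBounds` relative to the torus weights with constant `A𝒫'`, then
`IntegrationProperty P k 𝒞q A𝒫'` (`‖R_{k+1}F‖_{k:k+1,X} ≤ A𝒫'^{|X|_k}‖F‖_{k,X}` for connected
`k`-polymers and local `C^{r₀}` functionals). [cite: AdamsBuchholzKoteckyMuller2019, Lemma 8.4 (8.5)] -/
theorem integrationProperty_of_stepKernelBounds {L N Mord R n : ℕ} {θbar lam μ δ₁ δ₀ A𝒫 A𝒫' C₂ : ℝ}
    {𝒞 : ℕ → (Fin d → ZMod M) → ℝ} {𝒞q : (Fin d → ZMod M) → ℝ}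
    (hB : AbkmWeightBounds L N Mord R n θbar lam μ δ₁ δ₀ A𝒫 𝒞
      (abkmWeightData L N Mord R θbar (schedDelta δ₀ δ₁ N) 𝒞))
    {k : ℕ} (hS : StepKernelBounds (abkmWeightData L N Mord R θbar (schedDelta δ₀ δ₁ N) 𝒞) L k A𝒫' C₂ 𝒞q)
    (p r₀ : ℕ) (h A : ℝ) :
    IntegrationProperty (abkmNormParams L N Mord R p r₀ h θbar A (schedDelta δ₀ δ₁ N) 𝒞) k 𝒞q A𝒫' := by
  intro X hX _ F C hC hFd hFloc hF
  exact hS.tayNormLE_fluct hB.dominated hX _ hC hFd hFloc hF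

/-- **`R_{k+1}K(X) = fluct 𝒞q (K X)` is `C^{r₀}` for every connected `k`-polymer `X` when
`‖K‖_k^{(A)} ≤ C`** (concrete parameters, `A > 0`, kernel by predicate).
[cite: AdamsBuchholzKoteckyMuller2019, Lemma 8.4] -/
theorem contDiff_fluct_of_weakNormLE_of_stepKernelBounds {L N Mord R n p r₀ : ℕ}
    {θbar lam μ δ₁ δ₀ A𝒫 A𝒫' C₂ h A : ℝ} {𝒞 : ℕ → (Fin d → ZMod M) → ℝ} {𝒞q : (Fin d → ZMod M) → ℝ}
    (hB : AbkmWeightBounds L N Mord R n θbar lam μ δ₁ δ₀ A𝒫 𝒞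
      (abkmWeightData L N Mord R θbar (schedDelta δ₀ δ₁ N) 𝒞))
    {k : ℕ} (hS : StepKernelBounds (abkmWeightData L N Mord R θbar (schedDelta δ₀ δ₁ N) 𝒞) L k A𝒫' C₂ 𝒞q)
    (hA : 0 < A) {K : Finset (Fin d → ZMod M) → ((Fin d → ZMod M) → ℝ) → ℂ} {C : ℝ} (hC : 0 ≤ C)
    (hK : WeakNormLE (abkmNormParams L N Mord R p r₀ h θbar A (schedDelta δ₀ δ₁ N) 𝒞) k K C)
    (hKd : ∀ X, ContDiff ℝ r₀ (K X))
    (hKloc : ∀ X, IsPolymer (L ^ k) X → IsConn X →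
      IsGaugeLocal ((abkmNormParams L N Mord R p r₀ h θbar A (schedDelta δ₀ δ₁ N) 𝒞).gauge k X) (K X))
    {X : Finset (Fin d → ZMod M)} (hX : IsPolymer (L ^ k) X) (hc : IsConn X) :
    ContDiff ℝ r₀ (fluct 𝒞q (K X)) := by
  set P := abkmNormParams L N Mord R p r₀ h θbar A (schedDelta δ₀ δ₁ N) 𝒞 with hP
  have h1 : TayNormLE (P.gauge k X) r₀
      ((abkmWeightData L N Mord R θbar (schedDelta δ₀ δ₁ N) 𝒞).weight k X) (K X)
      (C * P.aFactor k X) := hK X hX hc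
  exact hS.contDiff_fluct hB.dominated X (P.gauge k X)
    (mul_nonneg hC (WeakNormLE.aFactor_pos hA k X).le) (hKd X) (hKloc X hX hc) h1

/-- **`K(X, φ + ·)` is `μ_{k+1}`-integrable for every connected `k`-polymer `X` when
`‖K‖_k^{(A)} ≤ C`** (concrete parameters, `A > 0`, kernel by predicate).
[cite: AdamsBuchholzKoteckyMuller2019, Lemma 8.4] -/
theorem integrable_comp_add_of_weakNormLE_of_stepKernelBounds {L N Mord R n p r₀ : ℕ}
    {θbar lam μ δ₁ δ₀ A𝒫 A𝒫' C₂ h A : ℝ} {𝒞 : ℕ → (Fin d → ZMod M) → ℝ} {𝒞q : (Fin d → ZMod M) → ℝ}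
    (hB : AbkmWeightBounds L N Mord R n θbar lam μ δ₁ δ₀ A𝒫 𝒞
      (abkmWeightData L N Mord R θbar (schedDelta δ₀ δ₁ N) 𝒞))
    {k : ℕ} (hS : StepKernelBounds (abkmWeightData L N Mord R θbar (schedDelta δ₀ δ₁ N) 𝒞) L k A𝒫' C₂ 𝒞q)
    (hA : 0 < A) {K : Finset (Fin d → ZMod M) → ((Fin d → ZMod M) → ℝ) → ℂ} {C : ℝ} (hC : 0 ≤ C)
    (hK : WeakNormLE (abkmNormParams L N Mord R p r₀ h θbar A (schedDelta δ₀ δ₁ N) 𝒞) k K C)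
    (hKd : ∀ X, ContDiff ℝ r₀ (K X))
    (hKloc : ∀ X, IsPolymer (L ^ k) X → IsConn X →
      IsGaugeLocal ((abkmNormParams L N Mord R p r₀ h θbar A (schedDelta δ₀ δ₁ N) 𝒞).gauge k X) (K X))
    {X : Finset (Fin d → ZMod M)} (hX : IsPolymer (L ^ k) X) (hc : IsConn X)
    (φ : (Fin d → ZMod M) → ℝ) :
    Integrable (fun ξ => K X (φ + ξ)) (stepMeasure 𝒞q) := by
  set P := abkmNormParams L N Mord R p r₀ h θbar A (schedDelta δ₀ δ₁ N) 𝒞 with hP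
  have h1 : TayNormLE (P.gauge k X) r₀
      ((abkmWeightData L N Mord R θbar (schedDelta δ₀ δ₁ N) 𝒞).weight k X) (K X)
      (C * P.aFactor k X) := hK X hX hc
  exact hS.integrable_comp_add hB.dominated X (P.gauge k X)
    (mul_nonneg hC (WeakNormLE.aFactor_pos hA k X).le) (hKd X) (hKloc X hX hc) h1 φ

/-- **`L^{dk}|γ_q| ≤ h²` from the predicate** when `C₂ ≤ h²` (the hypothesis shape of
`StepOperatorABKM.hamNorm_stepOpA_abkm_le` / `hamNorm_stepOpAInv_abkm_le`).
[cite: AdamsBuchholzKoteckyMuller2019, Lemma 10.5 (10.39)] -/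
theorem abs_gradCov_le_of_stepKernelBounds {W : WeightData (Fin d → ZMod M)} {L k : ℕ} {A𝒫 C₂ h : ℝ}
    {𝒞q : (Fin d → ZMod M) → ℝ} (hS : StepKernelBounds W L k A𝒫 C₂ 𝒞q) (hh2 : C₂ ≤ h ^ 2)
    (q : quadIndex d) : ((L ^ (d * k) : ℕ) : ℝ) * |gradCov 𝒞q q| ≤ h ^ 2 :=
  (hS.gradCov_le q).trans hh2

end Literature.MathematicalPhysics.StatisticalMechanics.GradientRG

end
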